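import Literature.NumberTheory.Automorphic.HidaIndependenceOfWeightTower
import HarnessLib

/-!
# Restricting the acting monoid in the level-action model does not change the cohomology

Topic `NumberTheory/Automorphic`; namespace `Literature.NumberTheory.Automorphic.LevelAction`;
definitions with bodies (the comparison isomorphisms) and theorems.  In the coefficients-at-`p`
model (`IntegralWeightHeckeModuleGL2`: sections `M(U, τ)` of a `Δ`-module `V` for a monoid
`Δ ⊇ U`, cohomology `H^i(U, τ) = H^i(Γ, M(U, τ))`, Hecke operators `[U α U]` for `α ∈ Δ`), only the
action of `U` enters `M(U, τ)` and only the action of `U α U` enters `[U α U]`.  Hence for a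
submonoid `Δ' ≤ Δ` containing `U` and an action `τ'` of `Δ'` agreeing with `τ`:

* `sections_eq_of_restrict` — `M(U, τ') = M(U, τ)` (same functions);
* `repIsoOfRestrict`, **`cohomologyIsoOfRestrict : H^i(U, τ') ≅ H^i(U, τ)`** (the identity on
  cochains);
* `heckeOp_eq_of_restrict`, **`cohomologyIsoOfRestrict_hom_comp_heckeCohomology`** — the Hecke
  operators `[U α U]`, `α ∈ Δ'`, correspond; `bijOn_ordinaryPart_of_restrict` — so do the
  `[U α U]`-ordinary parts.

Used to pass between the two bookkeeping monoids of the Hida-theory files (the integral monoid of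
the `𝒪`-lattice `SymCoeffLattice` and the multi-place Iwahori monoid of
`SymPowTensorIwahoriCoefficients`). [cite: Hida1994AIF, §1] [cite: KhareThorne2017, §6.4]

## References

* H. Hida, Ann. Inst. Fourier 44 (1994), §1 (held). [Hida1994AIF]
* C. Khare, J. A. Thorne, Amer. J. Math. 139 (2017), §6.4 (arXiv:1409.7007, held). [KhareThorne2017]
-/

noncomputable section

open CategoryTheory

universe u

namespace Literature.NumberTheory.Automorphic.LevelAction

variable {R : Type u} [CommRing R] {Γ 𝒢 : Type u} [Group Γ] [Group 𝒢] (ι : Γ →* 𝒢)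
  {Δ Δ' : Submonoid 𝒢} {V : Type u} [AddCommGroup V] [Module R V]
  {τ : Δ →* Module.End R V} {τ' : Δ' →* Module.End R V} {U : Subgroup 𝒢}

/-- The extended-by-zero actions on functions agree on `Δ'`. [folklore] -/
theorem act_fnAction_eq_of_restrict (h : Δ' ≤ Δ)
    (hττ' : ∀ (g : 𝒢) (hg : g ∈ Δ'), τ' ⟨g, hg⟩ = τ ⟨g, h hg⟩) {g : 𝒢} (hg : g ∈ Δ') :
    act Δ' (fnAction Δ' τ') g = act Δ (fnAction Δ τ) g := by
  rw [act_of_mem hg, act_of_mem (h hg)]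
  refine LinearMap.ext fun f => funext fun x => ?_
  rw [fnAction_apply, fnAction_apply, hττ' g hg]

/-- **`M(U, τ') = M(U, τ)`**: the sections only see the action of `U`. [folklore] -/
theorem sections_eq_of_restrict (h : Δ' ≤ Δ)
    (hττ' : ∀ (g : 𝒢) (hg : g ∈ Δ'), τ' ⟨g, hg⟩ = τ ⟨g, h hg⟩) (hU : U.toSubmonoid ≤ Δ') :
    sections Δ' τ' U = sections Δ τ U := by
  ext f
  rw [mem_sections_iff hU, mem_sections_iff (hU.trans h)]
  simp only [hττ']

/-- `M(U, τ') ≃ M(U, τ)` (the identity on functions). [folklore] -/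
def sectionsEquivOfRestrict (h : Δ' ≤ Δ)
    (hττ' : ∀ (g : 𝒢) (hg : g ∈ Δ'), τ' ⟨g, hg⟩ = τ ⟨g, h hg⟩) (hU : U.toSubmonoid ≤ Δ') :
    sections Δ' τ' U ≃ₗ[R] sections Δ τ U :=
  LinearEquiv.ofEq _ _ (sections_eq_of_restrict h hττ' hU)

/-- Unfolding `sectionsEquivOfRestrict`. [folklore] -/
@[simp]
theorem coe_sectionsEquivOfRestrict_apply (h : Δ' ≤ Δ)
    (hττ' : ∀ (g : 𝒢) (hg : g ∈ Δ'), τ' ⟨g, hg⟩ = τ ⟨g, h hg⟩) (hU : U.toSubmonoid ≤ Δ')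
    (f : sections Δ' τ' U) :
    ((sectionsEquivOfRestrict h hττ' hU f : sections Δ τ U) : 𝒢 → V) = f :=
  rfl

/-- **`M(U, τ') ≅ M(U, τ)` as `Γ`-representations** (left translation on both). [folklore] -/
def repIsoOfRestrict (h : Δ' ≤ Δ)
    (hττ' : ∀ (g : 𝒢) (hg : g ∈ Δ'), τ' ⟨g, hg⟩ = τ ⟨g, h hg⟩) (hU : U.toSubmonoid ≤ Δ') :
    Rep.of (rep ι Δ' τ' U) ≅ Rep.of (rep ι Δ τ U) :=
  Rep.mkIso (Representation.Equiv.mk (sectionsEquivOfRestrict h hττ' hU) fun _ =>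
    LinearMap.ext fun _ => Subtype.ext rfl)

/-- **The Hecke operators agree** for `α ∈ Δ'` (the representatives of `U α U / U` lie in `Δ'`).
[folklore] -/
theorem heckeOp_eq_of_restrict (h : Δ' ≤ Δ)
    (hττ' : ∀ (g : 𝒢) (hg : g ∈ Δ'), τ' ⟨g, hg⟩ = τ ⟨g, h hg⟩) (hU : U.toSubmonoid ≤ Δ')
    {α : 𝒢} (hα : α ∈ Δ') (f : 𝒢 → V) :
    heckeOp Δ' (fnAction Δ' τ') U α f = heckeOp Δ (fnAction Δ τ) U α f := by
  classical
  by_cases hfin : (ArithmeticQuotient.doubleCosetQuot U α).Finite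
  · rw [heckeOp_eq_sum hfin, heckeOp_eq_sum hfin, LinearMap.sum_apply, LinearMap.sum_apply]
    refine Finset.sum_congr rfl fun d hd => ?_
    rw [Set.Finite.mem_toFinset] at hd
    rw [act_fnAction_eq_of_restrict h hττ' (out_mem_of_mem_doubleCosetQuot hU hα hd)]
  · rw [heckeOp_eq_zero_of_infinite hfin, heckeOp_eq_zero_of_infinite hfin]

/-- The Hecke endomorphisms of the representations correspond under `repIsoOfRestrict`. [folklore] -/
theorem heckeRepHom_comp_repIsoOfRestrict_hom (h : Δ' ≤ Δ)
    (hττ' : ∀ (g : 𝒢) (hg : g ∈ Δ'), τ' ⟨g, hg⟩ = τ ⟨g, h hg⟩) (hU : U.toSubmonoid ≤ Δ')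
    {α : 𝒢} (hα : α ∈ Δ') :
    heckeRepHom ι Δ' τ' U hU hα ≫ (repIsoOfRestrict ι h hττ' hU).hom =
      (repIsoOfRestrict ι h hττ' hU).hom ≫ heckeRepHom ι Δ τ U (hU.trans h) (h hα) :=
  Rep.hom_ext (Representation.IntertwiningMap.ext (LinearMap.ext fun f =>
    Subtype.ext (heckeOp_eq_of_restrict h hττ' hU hα f)))

/-- **`H^i(U, τ') ≅ H^i(U, τ)`.** [cite: Hida1994AIF, §1] -/
def cohomologyIsoOfRestrict (h : Δ' ≤ Δ)
    (hττ' : ∀ (g : 𝒢) (hg : g ∈ Δ'), τ' ⟨g, hg⟩ = τ ⟨g, h hg⟩) (hU : U.toSubmonoid ≤ Δ') (i : ℕ) :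
    cohomology ι Δ' τ' U i ≅ cohomology ι Δ τ U i :=
  (groupCohomology.functor R Γ i).mapIso (repIsoOfRestrict ι h hττ' hU)

/-- `cohomologyIsoOfRestrict` is the functoriality map of `repIsoOfRestrict`. [folklore] -/
theorem cohomologyIsoOfRestrict_hom (h : Δ' ≤ Δ)
    (hττ' : ∀ (g : 𝒢) (hg : g ∈ Δ'), τ' ⟨g, hg⟩ = τ ⟨g, h hg⟩) (hU : U.toSubmonoid ≤ Δ') (i : ℕ) :
    (cohomologyIsoOfRestrict ι h hττ' hU i).hom =
      groupCohomology.map (MonoidHom.id Γ) (repIsoOfRestrict ι h hττ' hU).hom i :=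
  rfl

/-- **The Hecke operators `[U α U]`, `α ∈ Δ'`, correspond on cohomology.** [cite: KhareThorne2017, §6.4] -/
theorem cohomologyIsoOfRestrict_hom_comp_heckeCohomology (h : Δ' ≤ Δ)
    (hττ' : ∀ (g : 𝒢) (hg : g ∈ Δ'), τ' ⟨g, hg⟩ = τ ⟨g, h hg⟩) (hU : U.toSubmonoid ≤ Δ')
    {α : 𝒢} (hα : α ∈ Δ') (i : ℕ) :
    (cohomologyIsoOfRestrict ι h hττ' hU i).hom.hom ∘ₗ heckeCohomology ι Δ' τ' U hU hα i =
      heckeCohomology ι Δ τ U (hU.trans h) (h hα) i ∘ₗ (cohomologyIsoOfRestrict ι h hττ' hU i).hom.hom := by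
  rw [cohomologyIsoOfRestrict_hom]
  dsimp only [heckeCohomology]
  rw [← ModuleCat.hom_comp, ← ModuleCat.hom_comp, ← groupCohomology.map_id_comp,
    ← groupCohomology.map_id_comp, heckeRepHom_comp_repIsoOfRestrict_hom ι h hττ' hU hα]

/-- **The `[U α U]`-ordinary parts correspond** under `cohomologyIsoOfRestrict`. [folklore] -/
theorem bijOn_ordinaryPart_of_restrict (h : Δ' ≤ Δ)
    (hττ' : ∀ (g : 𝒢) (hg : g ∈ Δ'), τ' ⟨g, hg⟩ = τ ⟨g, h hg⟩) (hU : U.toSubmonoid ≤ Δ')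
    {α : 𝒢} (hα : α ∈ Δ') (i : ℕ) :
    Set.BijOn (cohomologyIsoOfRestrict ι h hττ' hU i).hom.hom
      (⨅ n : ℕ, LinearMap.range (heckeCohomology ι Δ' τ' U hU hα i ^ n) : Submodule R _)
      (⨅ n : ℕ, LinearMap.range (heckeCohomology ι Δ τ U (hU.trans h) (h hα) i ^ n) : Submodule R _) :=
  bijOn_iInf_range_pow_of_linearEquiv (cohomologyIsoOfRestrict ι h hττ' hU i).toLinearEquiv
    (cohomologyIsoOfRestrict_hom_comp_heckeCohomology ι h hττ' hU hα i)

end Literature.NumberTheory.Automorphic.LevelAction
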